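import Literature.Computability.AlgebraicComplexity.DefinableVNPWitness
import Literature.Computability.AlgebraicComplexity.ValiantConjecture
import Literature.Computability.AlgebraicComplexity.BurgisserTransfer
import HarnessLib

/-!
# `P/poly`-definable families are in `VNP`; Tavenas' Prop. 3.17 from the `VNP`-completeness of `PER`

Family-level conclusion of Valiant's criterion for the bit language of a family of univariate
integer polynomials definable in `P/poly` (Tavenas 2014, Déf. 3.11–3.12, `IsDefinableSeqIn`;
Prop. 3.10; proof of Prop. 3.17), on top of the one-index witness of
`DefinableVNPWitness.lean`:

* `DefVNP.hPoly`: the multilinear polynomial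
  `h_n = ∑_{α < 2^d} ∑_{i < 2^r} sign(a_α) · bit_i(|a_α|) · x^{bits α} z^{bits i}` of display (3.1)
  (`a_α` the coefficient of `X^α` in `f_n`), with `h_n(X^{2^j}; 2^{2^i}) = f_n`
  (`DefVNP.aeval_kpSubst_hPoly`) and multilinearity (`DefVNP.hPoly_multilinear`);
* `DefVNP.isVNPFamily_hPoly`: `(h_n) ∈ VNP` over any commutative ring — the `VP` witness is the
  polynomial `gW` with `∑_e gW(x, z, e) = h_n` (`bsum_eq_hPoly`, from `bsum_gW_eq` and the
  definability guarantee), of polynomially bounded size, degree and number of variables;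
* `Tavenas2014_prop_3_17_of_isVNPComplete_perPoly`: the named fact `Tavenas2014_prop_3_17`
  (`RealTauConjectureDepthFour.lean`) follows from the `VNP`-completeness of the permanent
  over `ℚ` (the tree's named fact `Literature.Computability.AlgebraicComplexity.isVNPComplete_perPoly`, Valiant 1979; Bürgisser 2000,
  Thm. 2.10), exactly as in the printed proof ("Par le critère de Valiant … (h_n) ∈ VNP⁰. Comme la
  famille du permanent est VNP-complète …", thesis p. 46).

Consequently the Koiran–Tavenas transfer theorem
(`not_isPBounded_constantFreeComplexity_perPoly_of_realTauConjecture`) rests on Bürgisser's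
Cor. 3.9, Bürgisser's Lemma 2.12 and the `VNP`-completeness of the permanent
(`RealTauConjectureAssembly.lean` with this file).

## References

* S. Tavenas, *Bornes inférieures et supérieures dans les circuits arithmétiques*, PhD thesis,
  ENS Lyon 2014, Prop. 3.10, Prop. 3.17 and its proof (display (3.1)).
* P. Bürgisser, *Completeness and Reduction in Algebraic Complexity Theory*, Springer 2000,
  Prop. 2.20 (Valiant's criterion), Thm. 2.10 (`VNP`-completeness of `PER`), Def. 2.3–2.6.
* L. G. Valiant, *Completeness classes in algebra*, STOC 1979.
-/

noncomputable section

open MvPolynomial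

universe u

namespace Literature.Computability.AlgebraicComplexity

open Complexity CircuitArith BoolGadgets

namespace DefVNP

variable {k : Type u} [CommRing k]

/-! ### Boolean sums along a renaming of the Boolean block -/

/-- **Valiant's `boolSum` along an enumeration of the Boolean block is `bsum`.** [cite: Burgisser2000, Def. 2.5] -/
theorem boolSum_rename_equiv {σ β : Type*} [DecidableEq β] [Fintype β] {m : ℕ} (ε : β ≃ Fin m)
    (G : MvPolynomial (σ ⊕ β) k) : boolSum (rename (Sum.map id ε) G) = bsum G := by
  unfold boolSum bsum
  have h1 : ∀ e : Fin m → Bool, aeval (Sum.elim X fun j => if e j then (1 : MvPolynomial σ k) else 0)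
      (rename (Sum.map id ε) G) = aeval (φb (k := k) (e ∘ ε)) G := by
    intro e
    have hφ : ((Sum.elim X fun j => if e j then (1 : MvPolynomial σ k) else 0) ∘ Sum.map id ε) = φb (k := k) (e ∘ ε) := by
      funext v
      cases v with
      | inl i => rfl
      | inr b => simp only [Function.comp_apply, Sum.map_inr, Sum.elim_inr, φb]; cases e (ε b) <;> simp [toK]
    rw [aeval_rename, hφ]
  simp only [h1]
  exact Fintype.sum_equiv ((Equiv.arrowCongr ε (Equiv.refl Bool)).symm) _ _ fun e => by
    congr 2

/-! ### The data of a definable family -/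

/-- The data of a family `(f_n) ⊂ ℤ[X]` definable in `P/poly` with the degree and coefficient
bounds of Prop. 3.17: the witnesses `p, B` of `IsDefinableSeqIn PPoly f` and the circuit family
of `B ∈ P/poly`. [cite: Tavenas2014, Déf. 3.12 and Prop. 3.17] -/
structure FamilyData where
  /-- the family -/
  f : ℕ → Polynomial ℤ
  /-- number of `x`-variables -/
  d : ℕ → ℕ
  /-- number of `z`-variables -/
  r : ℕ → ℕ
  /-- `d` is p-bounded -/
  hd : IsPBounded d
  /-- `r` is p-bounded -/
  hr : IsPBounded r
  /-- `α`-range of the definability guarantee -/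
  p : Polynomial ℕ
  /-- the bit language -/
  B : Language Bool
  /-- size bound of its circuits -/
  pB : Polynomial ℕ
  /-- its circuits -/
  CF : CircuitFamily
  /-- the circuits are polynomial-size `B₂`-circuits -/
  hCF : ∀ ℓ, (CF ℓ).IsOver B2 ∧ (CF ℓ).size ≤ pB.eval ℓ
  /-- and decide `B` -/
  hdec : CF.Decides B
  /-- the degree bound of the definability witness -/
  hp : ∀ n, (f n).natDegree < 2 ^ p.eval n
  /-- the bit language answers the sign-folded bits of the coefficients -/
  hB : ∀ n α j, α < 2 ^ p.eval n → (encUQuery n α j ∈ B ↔ sbit ((f n).coeff α) j = true)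
  /-- degree bound of Prop. 3.17 -/
  hdeg : ∀ n, (f n).natDegree < 2 ^ d n
  /-- coefficient bound of Prop. 3.17 -/
  hcoeff : ∀ n α, ((f n).coeff α).natAbs < 2 ^ 2 ^ r n

variable (Φ : FamilyData)

/-- The largest relevant query length at index `n`. [folklore] -/
def Lmax (n : ℕ) : ℕ := 2 * n + 2 * Φ.d n + (Φ.r n + 1) + 4

/-- The gate-variable block size at index `n`. [folklore] -/
def Msize (n : ℕ) : ℕ := Φ.pB.eval (Lmax Φ n)

/-- The witness parameters at index `n`. [cite: Tavenas2014, proof of Prop. 3.17] -/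
def params (n : ℕ) : Params where
  N := n
  D := Φ.d n
  R := Φ.r n
  P := Φ.p.eval n
  M := Msize Φ n
  CF := Φ.CF
  har ℓ := (Φ.hCF ℓ).1
  hM ℓ hℓ := (Φ.hCF ℓ).2.trans (Literature.Computability.Complexity.TM2Iter.eval_mono _ hℓ)

/-! ### The polynomial `h_n` -/

/-- The sign of `a` as `±1`: `1 - 2 [a < 0]`. [cite: Tavenas2014, proof of Prop. 3.17] -/
def sgnK (k : Type u) [CommRing k] (a : ℤ) : k := 1 - 2 * toK k (decide (a < 0))

/-- The coefficient of `x^α z^i` in `h_n`: `sign(a_α) · bit_i(|a_α|)`. [cite: Tavenas2014, proof of Prop. 3.17, (3.1)] -/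
def coefK (n α i : ℕ) : k := toK k (((Φ.f n).coeff α).natAbs.testBit i) * sgnK k ((Φ.f n).coeff α)

/-- **The polynomial `h_n` of display (3.1)** (with the sign of the coefficient folded in). [cite: Tavenas2014, proof of Prop. 3.17, (3.1)] -/
def hPoly (n : ℕ) : MvPolynomial (XZ (params Φ n)) k :=
  ∑ eA : Fin (params Φ n).D → Bool, ∑ eI : Fin (params Φ n).R → Bool,
    C (coefK Φ n (Nat.ofBits eA) (Nat.ofBits eI)) * xsel (params Φ n) eA * zsel (params Φ n) eI

/-- **The Boolean sum of the witness is `h_n`.** [cite: Tavenas2014, proof of Prop. 3.17] -/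
theorem bsum_eq_hPoly (n : ℕ) : bsum (gW (k := k) (params Φ n)) = hPoly Φ n := by
  rw [bsum_gW_eq (params Φ n) (fun x => Φ.B.boolIndicator x) Φ.hdec]
  refine Finset.sum_congr rfl fun eA _ => Finset.sum_congr rfl fun eI _ => ?_
  congr 3
  change toK k (decide (Nat.ofBits eA < 2 ^ Φ.p.eval n)) *
      (toK k (Φ.B.boolIndicator (encUQuery n (Nat.ofBits eA) (Nat.ofBits eI + 1))) *
        (1 - 2 * toK k (Φ.B.boolIndicator (encUQuery n (Nat.ofBits eA) 0)))) = coefK Φ n (Nat.ofBits eA) (Nat.ofBits eI)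
  unfold coefK sgnK
  by_cases hα : Nat.ofBits eA < 2 ^ Φ.p.eval n
  · rw [decide_eq_true hα, toK_true, one_mul]
    have hbit : ∀ j, Φ.B.boolIndicator (encUQuery n (Nat.ofBits eA) j) = sbit ((Φ.f n).coeff (Nat.ofBits eA)) j := by
      intro j
      rw [Bool.eq_iff_iff, ← Set.mem_iff_boolIndicator]
      exact Φ.hB n _ j hα
    rw [hbit, hbit]
    rfl
  · rw [decide_eq_false hα, toK_false, zero_mul]
    have hcoeff : (Φ.f n).coeff (Nat.ofBits eA) = 0 := by
      apply Polynomial.coeff_eq_zero_of_natDegree_lt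
      have := Φ.hp n; omega
    rw [hcoeff]
    simp

/-! ### `h_n(X^{2^j}; 2^{2^i}) = f_n` -/

/-- `toK` is the cast of `Bool.toNat`. [folklore] -/
theorem toK_eq_cast (b : Bool) : toK k b = (b.toNat : k) := by cases b <;> simp [toK]

/-- The selected `x`-monomial under the substitution (3.1) is `X^α`. [cite: Tavenas2014, proof of Prop. 3.17, (3.1)] -/
theorem aeval_kpSubst_xsel (n : ℕ) (eA : Fin (params Φ n).D → Bool) :
    MvPolynomial.aeval (kpSubst (params Φ n).D (params Φ n).R) (xsel (k := ℚ) (params Φ n) eA) =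
      (Polynomial.X : Polynomial ℚ) ^ Nat.ofBits eA := by
  unfold xsel
  rw [ofBits_eq_sum, map_prod]
  have h : ∀ t : Fin (params Φ n).D, MvPolynomial.aeval (kpSubst (params Φ n).D (params Φ n).R)
      (if eA t then (X (Sum.inl t) : MvPolynomial (XZ (params Φ n)) ℚ) else 1) =
      (Polynomial.X : Polynomial ℚ) ^ ((eA t).toNat * 2 ^ (t : ℕ)) := by
    intro t
    cases eA t
    · simp
    · simp [kpSubst]
  simp only [h]
  exact Finset.prod_pow_eq_pow_sum _ _ _

/-- The selected `z`-monomial under the substitution (3.1) is the constant `2^i`. [cite: Tavenas2014, proof of Prop. 3.17, (3.1)] -/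
theorem aeval_kpSubst_zsel (n : ℕ) (eI : Fin (params Φ n).R → Bool) :
    MvPolynomial.aeval (kpSubst (params Φ n).D (params Φ n).R) (zsel (k := ℚ) (params Φ n) eI) =
      Polynomial.C ((2 : ℚ) ^ Nat.ofBits eI) := by
  unfold zsel
  rw [ofBits_eq_sum, map_prod]
  have h : ∀ t : Fin (params Φ n).R, MvPolynomial.aeval (kpSubst (params Φ n).D (params Φ n).R)
      (if eI t then (X (Sum.inr t) : MvPolynomial (XZ (params Φ n)) ℚ) else 1) =
      Polynomial.C ((2 : ℚ) ^ ((eI t).toNat * 2 ^ (t : ℕ))) := by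
    intro t
    cases eI t
    · simp
    · simp [kpSubst]
  simp only [h]
  rw [← map_prod, Finset.prod_pow_eq_pow_sum]

/-- `sign(a) · |a| = a`. [folklore] -/
theorem sgnK_mul_natAbs (a : ℤ) : sgnK ℚ a * (a.natAbs : ℚ) = a := by
  unfold sgnK
  by_cases h : a < 0
  · rw [decide_eq_true h, toK_true]
    have : (a.natAbs : ℤ) = -a := by omega
    have h2 : ((a.natAbs : ℤ) : ℚ) = -(a : ℚ) := by rw [this]; simp
    rw [show ((a.natAbs : ℚ)) = ((a.natAbs : ℤ) : ℚ) by simp, h2]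
    ring
  · rw [decide_eq_false h, toK_false]
    have : (a.natAbs : ℤ) = a := by omega
    rw [show ((a.natAbs : ℚ)) = ((a.natAbs : ℤ) : ℚ) by simp, this]
    ring

/-- **`h_n(X^{2^0}, …, X^{2^{d-1}}, 2^{2^0}, …, 2^{2^{r-1}}) = f_n`** (display (3.1)). [cite: Tavenas2014, proof of Prop. 3.17, (3.1)] -/
theorem aeval_kpSubst_hPoly (n : ℕ) :
    MvPolynomial.aeval (kpSubst (params Φ n).D (params Φ n).R) (hPoly (k := ℚ) Φ n) = (Φ.f n).map (Int.castRingHom ℚ) := by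
  unfold hPoly
  rw [map_sum]
  have h1 : ∀ eA : Fin (params Φ n).D → Bool, MvPolynomial.aeval (kpSubst (params Φ n).D (params Φ n).R)
      (∑ eI : Fin (params Φ n).R → Bool, C (coefK Φ n (Nat.ofBits eA) (Nat.ofBits eI)) * xsel (k := ℚ) (params Φ n) eA * zsel (params Φ n) eI) =
      Polynomial.C (((Φ.f n).coeff (Nat.ofBits eA) : ℚ)) * Polynomial.X ^ Nat.ofBits eA := by
    intro eA
    rw [map_sum]
    have h2 : ∀ eI : Fin (params Φ n).R → Bool, MvPolynomial.aeval (kpSubst (params Φ n).D (params Φ n).R)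
        (C (coefK Φ n (Nat.ofBits eA) (Nat.ofBits eI)) * xsel (k := ℚ) (params Φ n) eA * zsel (params Φ n) eI) =
        Polynomial.C (coefK Φ n (Nat.ofBits eA) (Nat.ofBits eI) * (2 : ℚ) ^ Nat.ofBits eI) * Polynomial.X ^ Nat.ofBits eA := by
      intro eI
      rw [map_mul, map_mul, MvPolynomial.aeval_C, aeval_kpSubst_xsel, aeval_kpSubst_zsel, Polynomial.algebraMap_eq,
        map_mul]
      ring
    simp only [h2]
    rw [← Finset.sum_mul, ← map_sum]
    congr 2
    rw [sum_boolVec_eq_sum_range (fun i => coefK (k := ℚ) Φ n (Nat.ofBits eA) i * 2 ^ i)]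
    unfold coefK
    simp only [toK_eq_cast]
    change ∑ i ∈ Finset.range (2 ^ Φ.r n), _ = _
    rw [show ∑ i ∈ Finset.range (2 ^ Φ.r n), (((Φ.f n).coeff (Nat.ofBits eA)).natAbs.testBit i).toNat * sgnK ℚ ((Φ.f n).coeff (Nat.ofBits eA)) * (2 : ℚ) ^ i =
      sgnK ℚ ((Φ.f n).coeff (Nat.ofBits eA)) * ((∑ i ∈ Finset.range (2 ^ Φ.r n), 2 ^ i * (((Φ.f n).coeff (Nat.ofBits eA)).natAbs.testBit i).toNat : ℕ) : ℚ) by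
        rw [Nat.cast_sum, Finset.mul_sum]
        refine Finset.sum_congr rfl fun i _ => ?_
        push_cast; ring,
      sum_two_pow_mul_testBit_of_lt (Φ.hcoeff n (Nat.ofBits eA)), sgnK_mul_natAbs]
  simp only [h1]
  rw [sum_boolVec_eq_sum_range (fun α => Polynomial.C (((Φ.f n).coeff α : ℚ)) * Polynomial.X ^ α)]
  have hdeg : ((Φ.f n).map (Int.castRingHom ℚ)).natDegree < 2 ^ Φ.d n :=
    Polynomial.natDegree_map_le.trans_lt (Φ.hdeg n)
  conv_rhs => rw [((Φ.f n).map (Int.castRingHom ℚ)).as_sum_range_C_mul_X_pow' hdeg]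
  change ∑ α ∈ Finset.range (2 ^ Φ.d n), _ = _
  refine Finset.sum_congr rfl fun α _ => ?_
  rw [Polynomial.coeff_map]; rfl

/-! ### Multilinearity -/

/-- `degreeOf v (X w) ≤ [v = w]`. [folklore] -/
theorem degreeOf_X_le' {σ : Type*} [DecidableEq σ] (v w : σ) :
    degreeOf v (X w : MvPolynomial σ k) ≤ if v = w then 1 else 0 := by
  classical
  rw [degreeOf_def]
  calc Multiset.count v (degrees (X w : MvPolynomial σ k)) ≤ Multiset.count v {w} :=
        Multiset.count_le_of_le _ (degrees_X' w)
    _ = if v = w then 1 else 0 := by rw [Multiset.count_singleton]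

/-- The selected `x`-monomial has degree `≤ 1` in each `x`-variable and `0` in the `z`-variables. [folklore] -/
theorem degreeOf_xsel_le {π : Params} (eA : Fin π.D → Bool) (v : XZ π) :
    degreeOf v (xsel (k := k) π eA) ≤ match v with | .inl _ => 1 | .inr _ => 0 := by
  classical
  unfold xsel
  refine (degreeOf_prod_le _ _ _).trans ?_
  cases v with
  | inl t₀ =>
    calc ∑ t : Fin π.D, degreeOf (Sum.inl t₀ : XZ π) (if eA t then (X (Sum.inl t) : MvPolynomial (XZ π) k) else 1)
        ≤ ∑ t : Fin π.D, (if t₀ = t then 1 else 0) := Finset.sum_le_sum fun t _ => by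
          split_ifs with h1 h2 h2
          · exact (degreeOf_X_le' _ _).trans (by simp [h2])
          · exact (degreeOf_X_le' _ _).trans (by simp [h2])
          · rw [degreeOf_one]; exact Nat.zero_le _
          · rw [degreeOf_one]
      _ = 1 := by rw [Finset.sum_ite_eq]; simp
  | inr t₀ =>
    refine (Finset.sum_eq_zero fun t _ => ?_).le
    split_ifs
    · exact Nat.eq_zero_of_le_zero ((degreeOf_X_le' _ _).trans (by simp))
    · exact degreeOf_one _

/-- The selected `z`-monomial has degree `≤ 1` in each `z`-variable and `0` in the `x`-variables. [folklore] -/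
theorem degreeOf_zsel_le {π : Params} (eI : Fin π.R → Bool) (v : XZ π) :
    degreeOf v (zsel (k := k) π eI) ≤ match v with | .inl _ => 0 | .inr _ => 1 := by
  classical
  unfold zsel
  refine (degreeOf_prod_le _ _ _).trans ?_
  cases v with
  | inr t₀ =>
    calc ∑ t : Fin π.R, degreeOf (Sum.inr t₀ : XZ π) (if eI t then (X (Sum.inr t) : MvPolynomial (XZ π) k) else 1)
        ≤ ∑ t : Fin π.R, (if t₀ = t then 1 else 0) := Finset.sum_le_sum fun t _ => by
          split_ifs with h1 h2 h2
          · exact (degreeOf_X_le' _ _).trans (by simp [h2])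
          · exact (degreeOf_X_le' _ _).trans (by simp [h2])
          · rw [degreeOf_one]; exact Nat.zero_le _
          · rw [degreeOf_one]
      _ = 1 := by rw [Finset.sum_ite_eq]; simp
  | inl t₀ =>
    refine (Finset.sum_eq_zero fun t _ => ?_).le
    split_ifs
    · exact Nat.eq_zero_of_le_zero ((degreeOf_X_le' _ _).trans (by simp))
    · exact degreeOf_one _

/-- **`h_n` is multilinear.** [cite: Tavenas2014, proof of Prop. 3.17] -/
theorem hPoly_multilinear (n : ℕ) : ∀ m ∈ (hPoly (k := k) Φ n).support, ∀ v : XZ (params Φ n), m v ≤ 1 := by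
  classical
  intro m hm v
  revert m
  rw [← degreeOf_le_iff]
  unfold hPoly
  refine (degreeOf_sum_le _ _ _).trans (Finset.sup_le fun eA _ => ?_)
  refine (degreeOf_sum_le _ _ _).trans (Finset.sup_le fun eI _ => ?_)
  refine (degreeOf_mul_le _ _ _).trans ?_
  refine (Nat.add_le_add_right (degreeOf_mul_le _ _ _) _).trans ?_
  have h0 : degreeOf v (C (coefK (k := k) Φ n (Nat.ofBits eA) (Nat.ofBits eI)) : MvPolynomial (XZ (params Φ n)) k) = 0 := degreeOf_C _ _
  have h1 := degreeOf_xsel_le (k := k) eA v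
  have h2 := degreeOf_zsel_le (k := k) eI v
  cases v with
  | inl t => simp only at h1 h2; omega
  | inr t => simp only at h1 h2; omega

/-! ### `(h_n) ∈ VNP` -/

/-- `x ≤ c` gives p-boundedness of the constant bound. [folklore] -/
theorem isPBounded_of_le_poly {t : ℕ → ℕ} (q : Polynomial ℕ) (h : ∀ n, t n ≤ q.eval n) : IsPBounded t :=
  (isPBounded_iff_exists_polynomial_holds t).2 ⟨q, h⟩

/-- `Lmax` is p-bounded. [folklore] -/
theorem isPBounded_Lmax : IsPBounded (Lmax Φ) := by
  unfold Lmax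
  have h1 : IsPBounded fun n => 2 * n := IsPBounded.mul_holds (IsPBounded.const 2) IsPBounded.id
  have h2 : IsPBounded fun n => 2 * Φ.d n := IsPBounded.mul_holds (IsPBounded.const 2) Φ.hd
  have h3 : IsPBounded fun n => Φ.r n + 1 := IsPBounded.add_holds Φ.hr (IsPBounded.const 1)
  exact IsPBounded.add_holds (IsPBounded.add_holds (IsPBounded.add_holds h1 h2) h3) (IsPBounded.const 4)

/-- The block size `M` is p-bounded. [folklore] -/
theorem isPBounded_Msize : IsPBounded (Msize Φ) := by
  unfold Msize
  exact IsPBounded.comp_holds (isPBounded_of_le_poly Φ.pB fun m => le_rfl) (isPBounded_Lmax Φ)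

/-- The number of Boolean variables. [folklore] -/
theorem card_BV (π : Params) : Fintype.card (BV π) = π.D + ((π.R + 1) + (π.M + π.M)) := by
  simp only [BV, Fintype.card_sum, Fintype.card_fin]

/-- The number of Boolean variables is p-bounded. [folklore] -/
theorem isPBounded_card_BV : IsPBounded fun n => Fintype.card (BV (params Φ n)) := by
  have h : (fun n => Fintype.card (BV (params Φ n))) = fun n => Φ.d n + ((Φ.r n + 1) + (Msize Φ n + Msize Φ n)) := by
    funext n; rw [card_BV]; rfl
  rw [h]
  exact IsPBounded.add_holds Φ.hd (IsPBounded.add_holds (IsPBounded.add_holds Φ.hr (IsPBounded.const 1))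
    (IsPBounded.add_holds (isPBounded_Msize Φ) (isPBounded_Msize Φ)))

/-- The cost bound `gWCost d r M` is p-bounded. [folklore] -/
theorem isPBounded_gWCost : IsPBounded fun n => gWCost (Φ.d n) (Φ.r n) (Msize Φ n) := by
  have hd := Φ.hd; have hr := Φ.hr; have hM := isPBounded_Msize Φ
  have c := fun m : ℕ => IsPBounded.const m
  have hs : IsPBounded fun n => scalCost (Φ.d n) (Φ.r n) (Msize Φ n) := by
    unfold scalCost
    exact IsPBounded.add_holds (IsPBounded.add_holds (IsPBounded.add_holds (IsPBounded.mul_holds (c 6) hd)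
      (IsPBounded.mul_holds (c 9) hr)) (IsPBounded.mul_holds (c 120) hM)) (c 26)
  unfold gWCost
  refine IsPBounded.add_holds (IsPBounded.add_holds (IsPBounded.add_holds ?_ (IsPBounded.mul_holds (c 5) hd)) ?_) (c 2)
  · exact IsPBounded.mul_holds (IsPBounded.add_holds hd (c 1)) (IsPBounded.add_holds (IsPBounded.mul_holds
      (IsPBounded.add_holds hr (c 2)) (IsPBounded.add_holds hs (c 1))) (c 1))
  · exact IsPBounded.add_holds (IsPBounded.mul_holds hr (IsPBounded.add_holds (IsPBounded.mul_holds (c 12) hr) (c 24)))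
      (IsPBounded.mul_holds (c 5) hr)

/-- The degree bound of the witness is p-bounded. [folklore] -/
theorem isPBounded_gWDeg : IsPBounded fun n =>
    (2 * Φ.d n + 3 * Φ.r n + 6 * Msize Φ n + 7) + 2 * Φ.d n + Φ.r n * (Φ.r n + 3) := by
  have hd := Φ.hd; have hr := Φ.hr; have hM := isPBounded_Msize Φ
  have c := fun m : ℕ => IsPBounded.const m
  exact IsPBounded.add_holds (IsPBounded.add_holds (IsPBounded.add_holds (IsPBounded.add_holds (IsPBounded.add_holds
    (IsPBounded.mul_holds (c 2) hd) (IsPBounded.mul_holds (c 3) hr)) (IsPBounded.mul_holds (c 6) hM)) (c 7))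
    (IsPBounded.mul_holds (c 2) hd)) (IsPBounded.mul_holds hr (IsPBounded.add_holds hr (c 3)))

/-- An enumeration of the Boolean variables. [folklore] -/
def bvEquiv (n : ℕ) : BV (params Φ n) ≃ Fin (Fintype.card (BV (params Φ n))) := Fintype.equivFin _

/-- The `VP` witness family in Valiant's variable shape `σ n ⊕ Fin (u n)`. [cite: Tavenas2014, proof of Prop. 3.17] -/
def gFam (n : ℕ) : MvPolynomial ((Fin (Φ.d n) ⊕ Fin (Φ.r n)) ⊕ Fin (Fintype.card (BV (params Φ n)))) k :=
  rename (Sum.map id (bvEquiv Φ n)) (gW (params Φ n))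

/-- **The witness family is in `VP`.** [cite: Burgisser2000, Prop. 2.20 (g ∈ VP)] -/
theorem isVPFamily_gFam : IsVPFamily (gFam (k := k) Φ) := by
  refine ⟨⟨?_, ?_⟩, ?_⟩
  · -- number of variables
    have h : (fun n => Fintype.card ((Fin (Φ.d n) ⊕ Fin (Φ.r n)) ⊕ Fin (Fintype.card (BV (params Φ n))))) =
        fun n => (Φ.d n + Φ.r n) + Fintype.card (BV (params Φ n)) := by
      funext n; simp only [Fintype.card_sum, Fintype.card_fin]
    rw [h]
    exact IsPBounded.add_holds (IsPBounded.add_holds Φ.hd Φ.hr) (isPBounded_card_BV Φ)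
  · -- degree
    refine (isPBounded_gWDeg Φ).mono fun n => ?_
    exact (totalDegree_rename_le _ _).trans (totalDegree_gW_le (params Φ n))
  · -- complexity
    refine (isPBounded_gWCost Φ).mono fun n => ?_
    exact (complexity_rename_le_holds' _ _).trans (complexity_gW_le (params Φ n))

/-- `h_n` has degree `≤ d + r`. [folklore] -/
theorem totalDegree_hPoly_le (n : ℕ) : (hPoly (k := k) Φ n).totalDegree ≤ Φ.d n + Φ.r n := by
  unfold hPoly
  refine (totalDegree_finsetSum _ _).trans (Finset.sup_le fun eA _ => ?_)
  refine (totalDegree_finsetSum _ _).trans (Finset.sup_le fun eI _ => ?_)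
  refine (totalDegree_mul _ _).trans ?_
  refine (Nat.add_le_add_right (totalDegree_mul _ _) _).trans ?_
  have h0 : (C (coefK (k := k) Φ n (Nat.ofBits eA) (Nat.ofBits eI)) : MvPolynomial (XZ (params Φ n)) k).totalDegree = 0 := totalDegree_C _
  rw [h0, zero_add]
  refine Nat.add_le_add ?_ ?_
  · unfold xsel
    refine (totalDegree_finsetProd _ _).trans ?_
    calc ∑ t : Fin (params Φ n).D, (if eA t then (X (Sum.inl t) : MvPolynomial (XZ (params Φ n)) k) else 1).totalDegree
        ≤ ∑ _t : Fin (params Φ n).D, 1 := Finset.sum_le_sum fun t _ => by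
          split_ifs
          · exact totalDegree_X_le_one' (k := k) _
          · rw [totalDegree_one]; exact Nat.zero_le _
      _ = Φ.d n := by simp only [Finset.sum_const, Finset.card_univ, Fintype.card_fin, smul_eq_mul, mul_one]; rfl
  · unfold zsel
    refine (totalDegree_finsetProd _ _).trans ?_
    calc ∑ t : Fin (params Φ n).R, (if eI t then (X (Sum.inr t) : MvPolynomial (XZ (params Φ n)) k) else 1).totalDegree
        ≤ ∑ _t : Fin (params Φ n).R, 1 := Finset.sum_le_sum fun t _ => by
          split_ifs
          · exact totalDegree_X_le_one' (k := k) _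
          · rw [totalDegree_one]; exact Nat.zero_le _
      _ = Φ.r n := by simp only [Finset.sum_const, Finset.card_univ, Fintype.card_fin, smul_eq_mul, mul_one]; rfl

/-- **`(h_n)` is a `VNP` family** (Valiant's criterion for the bit language, with the sign and the
shift of the sign-folded encoding handled). [cite: Tavenas2014, Prop. 3.10 and proof of Prop. 3.17] -/
theorem isVNPFamily_hPoly : IsVNPFamily (σ := fun n => Fin (Φ.d n) ⊕ Fin (Φ.r n)) (hPoly (k := k) Φ) := by
  classical
  refine ⟨⟨?_, (IsPBounded.add_holds Φ.hd Φ.hr).mono fun n => totalDegree_hPoly_le Φ n⟩,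
    fun n => Fintype.card (BV (params Φ n)), gFam Φ, isVPFamily_gFam Φ, fun n => ?_⟩
  · have h : (fun n => Fintype.card (Fin (Φ.d n) ⊕ Fin (Φ.r n))) = fun n => Φ.d n + Φ.r n := by
      funext n; simp
    rw [h]; exact IsPBounded.add_holds Φ.hd Φ.hr
  · show hPoly Φ n = boolSum (gFam Φ n)
    rw [gFam, boolSum_rename_equiv]
    exact (bsum_eq_hPoly Φ n).symm

/-! ### Proposition 3.17 from the `VNP`-completeness of the permanent -/

/-- Renaming a projection gives a projection. [cite: Burgisser2000, Def. 2.6(1)] -/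
theorem IsProjection.rename' {σ τ τ' : Type*} {g : MvPolynomial τ k} {f : MvPolynomial σ k}
    (h : IsProjection g f) (φ : τ → τ') : IsProjection (rename φ g) f := by
  obtain ⟨a, ha, rfl⟩ := h
  refine ⟨fun i => rename φ (a i), fun i => ?_, ?_⟩
  · rcases ha i with ⟨j, hj⟩ | ⟨c, hc⟩
    · left; exact ⟨φ j, by show rename φ (a i) = _; rw [hj, rename_X]⟩
    · right; exact ⟨c, by show rename φ (a i) = _; rw [hc, rename_C]⟩
  · rw [← AlgHom.comp_apply]
    congr 1
    apply MvPolynomial.algHom_ext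
    intro i
    simp

end DefVNP

open DefVNP

/-- **Tavenas' Proposition 3.17 from the `VNP`-completeness of the permanent over `ℚ`**
(`Literature.PNP.isVNPComplete_perPoly ℚ`, Valiant 1979 / Bürgisser 2000 Thm. 2.10), following the
printed proof: the multilinear `h_n` of display (3.1) is in `VNP` by Valiant's criterion applied to
the `P/poly` bit language (`DefVNP.isVNPFamily_hPoly`), hence a p-projection of the permanent. [cite: Tavenas2014, Prop. 3.17] -/
theorem Tavenas2014_prop_3_17_of_isVNPComplete_perPoly (hc : Literature.Computability.AlgebraicComplexity.isVNPComplete_perPoly ℚ) :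
    Tavenas2014_prop_3_17 := by
  classical
  intro f d r hd hr hdef hdeg hcoeff
  obtain ⟨p, q, hp, -, B, hBP, hB⟩ := hdef
  have hBP' := hBP
  simp only [PPoly, Set.mem_iUnion] at hBP'
  obtain ⟨pB, CF, hCF, hdec⟩ := hBP'
  let Φ : FamilyData :=
    { f := f, d := d, r := r, hd := hd, hr := hr, p := p, B := B, pB := pB, CF := CF, hCF := hCF, hdec := hdec,
      hp := hp, hB := hB, hdeg := hdeg, hcoeff := hcoeff }
  have hVNP : IsVNPFamily (σ := fun n => Fin (d n) ⊕ Fin (r n)) (hPoly (k := ℚ) Φ) := isVNPFamily_hPoly Φ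
  have hVNP' := hVNP.renameEquiv (fun n => (finSumFinEquiv : Fin (d n) ⊕ Fin (r n) ≃ Fin (d n + r n)))
  have h2 : ringChar ℚ ≠ 2 := by rw [ringChar.eq_zero]; norm_num
  obtain ⟨t, ht, hproj⟩ := (hc h2).2 (fun n => d n + r n) _ hVNP'
  refine ⟨t, ht, fun n => ⟨hPoly Φ n, ?_, hPoly_multilinear Φ n, aeval_kpSubst_hPoly Φ n⟩⟩
  have := IsProjection.rename' (hproj n) (finSumFinEquiv (m := d n) (n := r n)).symm
  have hre : rename (finSumFinEquiv (m := d n) (n := r n)).symm (renameEquiv ℚ finSumFinEquiv (hPoly (k := ℚ) Φ n)) = hPoly Φ n := by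
    rw [MvPolynomial.renameEquiv_apply, rename_rename, Equiv.symm_comp_self, rename_id]; rfl
  rw [hre] at this
  exact this

end Literature.Computability.AlgebraicComplexity
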